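import Literature.MathematicalPhysics.QuantumFieldTheory.Balaban1983to89.B16Cor3FactorLeavesOfBudget

/-!
# `Balaban1983to89.B16Improved189ArbitraryRegionFull` — [Balaban1989LargeFieldII] p. 387 ll. 23–27 WITH THE PRINTED
BUDGET: the improved (1.89) `𝐓 ≤ exp(−2(1+β₀)⁻¹p₀(g_k) − κ₁d_k(X))` for an ARBITRARY large-field region (horizon `K ≥ 1`)
from (1.80) AS PRINTED — no strengthening, no `p₀` spent — because `S` adds ten layers (`d′_{k+1}(S(X)) ≥ 1`); and the
Cor.-3 chain's factor leaves `hZ` ∕ `hw` ∕ `hY` re-issued with the FULL budget `c₀ = 2(1+β₀)⁻¹p₀(g_k)`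

T. Bałaban, *Large field renormalization. II. Localization, exponentiation, and bounds for the 𝐑 operation*, Commun.
Math. Phys. **122** (1989) 355–392, doi:10.1007/bf01238433 [Balaban1989LargeFieldII] (cell paper B16 = [V]; PDF held
`paper:balaban1989-cmp122-large-field-ii`, journal page = PDF page + 354; p. 384 = PDF 30, p. 387 = PDF 33).  [III] =
[Balaban1988Convergent] ((2.7), (2.9) pp. 255–256; Cor. 3 (2.50) p. 264); [I] = [Balaban1987RG1] p. 257 (`d_j(X)`).

statement-level bookkeeping of a published proof with citation tags; proofs kernel-checked; nothing here is a claim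
about the Yang–Mills mass gap

CITATION HEADER ∕ WHAT IS PRINTED.  p. 387 [PDF 33] ll. 21–27 (text layer; p411685 cites «ll. 25–29»), verbatim: *"At first, the domain X in the definition
(1.71) satisfies the assumption of the statement with K = 0, therefore κ_k(X) ≧ 0, and we have the fundamental inequality
𝐓′_k(X)1 ≦ exp(−2(1+β₀)⁻¹p₀(g_k)). (1.89) Next, we have noticed already that the inequality (1.79) holds for the
𝐓-operation connected with an arbitrary large field region. The inequality (1.80) holds quite generally for such regions,
hence also an improved bound (1.89), with the additional term −κ₁d_k(X) in the exponential. This implies the inequality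
(2.50) [III], hence Corollary 3."*  p. 384 [PDF 30]: *"we take the cover Z′ of Z by a smallest union of LMR_{j+1}-cubes,
and we add ten layers of such cubes. We denote the obtained domain by S(Z), i.e., S(Z) = Z′^{~10}"*; (1.80) ibid.

THE LOCATED ITEM (cell GAPS G-adv3-6 (3) «the FULL-budget form as printed … NOT REPAIRED»; W-SEAT-START-LIST §1
n13 item 2).  The tree supplies the Cor.-3 chain's per-component weight `hw ∕ hZ : 𝐓_X ≤ exp(−c₀ − κ₁d_k(X))` with
HALF the printed budget, `c₀ = (1+β₀)⁻¹p₀(g_k)`: for the domains of (1.71) (`K = 0`) by the size trade against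
condition (i) (`B16Cor3FactorLeavesOfBudget.weight_horizon0_torus`), for the components of `Z_k` (`K ≥ 1`) by
`B16Improved189.improved189_of_budget_general` ∕ n13-d's `improved189_arbitrary_ofIndex`, whose comparison `d_k(X) ≤
c(LR_{k+1})^d(d′_{k+1}(S(X)) + 1)` leaves the «+1» deficit `κ₁c(LR_{k+1})^d` paid from half the `p₀`-budget (`hdef`).
THIS FILE removes both halvings.  (a) `K ≥ 1`: in the index model `S(X) = Z′^{~10}` is never a point — ten layers ⇒
`d′_{k+1}(S(X)) = treeLen (Sop q X₀) ≥ 1` (§1) — so `d′ + 1 ≤ 2d′` and the deficit is absorbed by the `n = k+1` term of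
(1.80) ITSELF at the price of DOUBLING the located slope clause (`2κ₁cL^d ≤ O(1)M^dR_{k+1}`, constants only: «for p₀
large and γ small enough»): the full budget from (1.80) AS PRINTED (§§2–3).  (b) `K = 0`: (1.80)⁺ of
`B16Improved189FullBudget` at the horizon reads `κ₁d_k(Y) ≤ κ_k(Y)` (`controlsT_zero_iff`; inhabited in the index model
by `B16Improved189FullBudgetIndex`), which with the factor form gives the full budget (`weight_horizon0_full_torus`).
(c) The chain's factor leaves re-issued with ONE constant `c₀ ≤ P` (print: `c₀ = 2(1+β₀)⁻¹p₀(g_k) ≤ 2p₀(g_{j(X)}) = P`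
by (2.7a) [III]) in the END theorems' hypothesis shapes (§4).

WHAT THIS FILE PROVES (kernel-checked, zero `sorry`, theorems only — no `def`; axioms standard; BY NAME over
`B16Improved189ArbitraryRegion` §§1–4, §6, §9, `B16Improved189FullBudget.controlsT_zero_iff`, `B16Cor3FactorLeavesOfBudget`
§1, `B16MergeGeometry.sub_one_le_treeLen_of_apart` — nothing re-proved):
§1 `update_succ_mem_collar`, **`one_le_treeLen_Sop`** (`d′_{k+1}(S(X)) ≥ 1`, `d ≥ 1`).
§2 **`improved189_full_of_budget_general`** (the sibling's lemma with `1 ≤ d′`, `hslope2`, NO `hdef`; any `c₀ ≤ P`).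
§3 **`improved189_arbitrary_full_ofIndex`** (index model, no geometric hypothesis), `improved189_arbitrary_full_torus`,
   `weight_horizon0_full_torus` (`K = 0` from (1.80)⁺).
§4 **`hZ_full_of_budget_torus`** (`𝐓″1` reading), **`hw_full_of_budget_torus`** (Wilson reading), **`hY_full_of_controlsT_torus`**
   — the chain's factor leaves with ONE constant `c₀`, in the exact hypothesis shapes of the END theorems
   `B16Cor3CurlyGas.uvIneq_of_repr172_torus_of_ineq249_of_gas` (`hZ`, `hY`), `B16Cor3Torus.uvIneq_of_repr172_wilson_torus`
   (`hw`, `hY`) and of the record junction `B16NodeKnitRecord13CoPH.uvIneq_at_record₁₃CoPH_of_gas` with `c := fun _ => c₀`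
   (so the entropy term reads `M⁻⁴K₀(64,8)·2e^{−c₀}`, `c₀ = 2(1+β₀)⁻¹p₀(g_k)`); no END theorem is re-issued.
§5 `improved189_arbitrary_full_of_invariant` (from `ScaleData.Invariant`), `improved189_arbitrary_full_ofIndexProfile`
   (§3 read from the `B16Lem384Induction` profile, `hsize`∕`hRq` derived).
§6 `toy_full_of_budget_general` — §2's hypotheses jointly inhabited by explicit numbers with a non-zero size (A6).
HONEST SCOPE ∕ A6.  (a) Index model of the siblings (cell DIVERGENCE D-b02g9.1: identification with print's domains NOT
claimed); §1's «ten layers» is the cell's typed reading of p. 384 (`Sop q = collar^[10] ∘ closureIdx q`); print's own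
`S(Z) = Z′^{~10}` has `d′ ≥ 1` for the same reason.  (b) Per-component INPUTS stay hypotheses exactly as in
`B16Cor3FactorLeavesOfBudget` (factor forms, (1.80), (1.80)⁺ at the horizon, lifts, `c₀ ≤ P`); jointly satisfiable at the
bookkeeping level (`B16Improved189FullBudget.toy_history_full`, `B16Lem384Induction` §6, and §6 here for §2's clauses); LOCATED.
(c) Which budget (2.50) [III] needs is unprinted (GAPS G-adv3-2, G-B16-08 (c)); the chain closes with either — this file
shows the PRINTED one is available.  (d) Nothing of (1.79)–(1.89) asserted about Bałaban's densities; N13 NOT discharged;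
count-neutral; one finite 𝕋⁴ programme at fixed ε, Bałaban AS PRINTED; R4 closes the conditional finite-𝕋⁴ rung
`BalabanLadder.UV` only — nothing continuum ∕ OS ∕ mass gap ∕ Clay.  Seat `pub-ymgap-dag-n13-w2` (g0), YM-DAG node N13
[B16] Cor. 3, `--supports stmt-QuantumFields-20542`.
-/

noncomputable section

namespace Literature.MathematicalPhysics.QuantumFieldTheory.Balaban1983to89.B16Improved189ArbitraryRegionFull

open Literature.MathematicalPhysics.QuantumFieldTheory.Balaban1983to89
open Literature.MathematicalPhysics.QuantumFieldTheory.Balaban1983to89.B13ScaleTransfer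
open Literature.MathematicalPhysics.QuantumFieldTheory.Balaban1983to89.TreeLength
open Literature.MathematicalPhysics.QuantumFieldTheory.Balaban1983to89.B16SProfile
open Literature.MathematicalPhysics.QuantumFieldTheory.Balaban1983to89.B13Factor210Literal (fineCubes)
open Literature.MathematicalPhysics.QuantumFieldTheory.Balaban1983to89.B16Ineq197ClassOne
  (fineCubes_nonempty_iff faceConnected_fineCubes)
open Literature.MathematicalPhysics.QuantumFieldTheory.Balaban1983to89.B16StoppingRule (CondI)
open Literature.MathematicalPhysics.QuantumFieldTheory.Balaban1983to89.B16MergeGeometry (sub_one_le_treeLen_of_apart)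
open Literature.MathematicalPhysics.QuantumFieldTheory.Balaban1983to89.B16Improved189FullBudget (controlsT_zero_iff)
open Literature.MathematicalPhysics.QuantumFieldTheory.Balaban1983to89.B16Improved189ArbitraryRegion
  (hgeo_of_Sop cost_succ_le_of_controls closureIdx_subset_Sop torus_dj_le_treeLen_of_lift profile_entry_succ
    dictionary_of_exponents)
open Literature.MathematicalPhysics.QuantumFieldTheory.Balaban1983to89.B16Cor3FactorLeavesOfBudget
  (pi_one_le_prod_of_forall_mem)
open Literature.MathematicalPhysics.QuantumFieldTheory.Balaban1983to89.TreeLengthTorus (tsys proj)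
open Literature.MathematicalPhysics.QuantumFieldTheory.Balaban1983to89.B16Cor3Ops (PosOp Repr172)

variable {n : ℕ}

/-! ## §1. `S` adds ten layers: `d′_{k+1}(S(X)) ≥ 1` in the index model -/

/-- One layer: if `c ∈ X` then the index cube one step along the axis `μ` from `c` lies in the collar `X^{~}` of `X`
(`collar X = ⋃_{x∈X} block x`, `block x = box x 1`). [cite: Balaban1989LargeFieldII, p.384 (definition of S: «we add ten layers of such cubes»)] -/
theorem update_succ_mem_collar {X : Finset (Pt n)} {c : Pt n} (hc : c ∈ X) (μ : Fin n) :
    Function.update c μ (c μ + 1) ∈ collar X := by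
  rw [mem_collar]
  refine ⟨c, hc, ?_⟩
  rw [block_eq_box, mem_box]
  intro i
  by_cases h : i = μ
  · subst h; simp; omega
  · simp [Function.update_of_ne h]

/-- **`S(X)` IS NEVER A POINT**: for a non-empty face-connected family `X₀` of MR_k-cube indices (dimension `d ≥ 1`) the
domain `S(X) = Z′^{~10}` — the cover `Z′` by the next cubes with TEN LAYERS added (p. 384) — has linear size
`d′_{k+1}(S(X)) = treeLen (Sop q X₀) ≥ 1`: with any `c ∈ Z′`, the cubes `c` and `c + 2e_μ` both lie in `S(X)` (two of the
ten layers) and are `2` apart (`B16MergeGeometry.sub_one_le_treeLen_of_apart`). [cite: Balaban1989LargeFieldII, p.384 (definition of S), (1.80)] -/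
theorem one_le_treeLen_Sop (hn : 0 < n) {q : ℕ} (hq : 0 < q) {X₀ : Finset (Pt n)} (hX : X₀.Nonempty)
    (hXc : FaceConnected X₀) : (1 : ℝ) ≤ treeLen (Sop q X₀) := by
  obtain ⟨c, hc⟩ := closureIdx_nonempty (L := q) hX
  set μ : Fin n := ⟨0, hn⟩
  -- `c + e_μ ∈ Z′^{~}`, `c + 2e_μ ∈ Z′^{~2} ⊆ Z′^{~10} = S(X)`
  have h1 : Function.update c μ (c μ + 1) ∈ collar (closureIdx q X₀) := update_succ_mem_collar hc μ
  have h2 : Function.update c μ (c μ + 2) ∈ collar (collar (closureIdx q X₀)) := by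
    have h := update_succ_mem_collar h1 μ
    have e : Function.update (Function.update c μ (c μ + 1)) μ (Function.update c μ (c μ + 1) μ + 1)
        = Function.update c μ (c μ + 2) := by
      rw [Function.update_idem, Function.update_self]
      congr 1
      ring
    rw [e] at h
    exact h
  have hsub : collar (collar (closureIdx q X₀)) ⊆ Sop q X₀ := by
    show collar^[2] (closureIdx q X₀) ⊆ collar^[10] (closureIdx q X₀)
    rw [show (10 : ℕ) = 8 + 2 by rfl, Function.iterate_add_apply]
    exact subset_iterate_collar 8 _
  have hy : Function.update c μ (c μ + 2) ∈ Sop q X₀ := hsub h2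
  have hx : c ∈ Sop q X₀ := closureIdx_subset_Sop q X₀ hc
  have hadm : ∃ T, Admissible (Sop q X₀) T := by
    obtain ⟨T, hT, -⟩ := exists_admissible (Sop_nonempty q hX) (faceConnected_Sop hq hXc)
    exact ⟨T, hT⟩
  have h := sub_one_le_treeLen_of_apart hadm hx hy (μ := μ) (m := 2) le_rfl (by simp)
  norm_num at h
  exact h

/-! ## §2. The full budget for a region with `K ≥ 1`: hgeo's «+1» absorbed by `d′ ≥ 1`, no `p₀` spent -/

/-- **THE IMPROVED (1.89) WITH THE FULL BUDGET FOR A REGION WITH `K ≥ 1`** — `B16Improved189.improved189_of_budget_general`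
WITHOUT the deficit clause `hdef` (which spent half the `p₀`-budget): from the factor form `𝐓 ≤ exp(−κ − P)` (p. 384), the
`n = k+1` term of (1.80) `cost_{k+1}(d′) ≤ κ` (`hcost`), the comparison `d_k(X) ≤ c(LR_{k+1})^d(d′ + 1)` (`hgeo`), `d′ ≥ 1`
(`hd'`; §1) and the located slope clause DOUBLED (`hslope2`, constants only): `κ₁d_k(X) ≤ κ₁c(LR)^d(d′+1) ≤ 2κ₁c(LR)^d·d′
≤ cost_{k+1}(d′) ≤ κ`, hence `𝐓 ≤ exp(−c₀ − κ₁d_k(X))` for every `c₀ ≤ P` — with print's `P = 2p₀(g_{j(X)}) ≥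
2(1+β₀)⁻¹p₀(g_k) = c₀` ((2.7a) [III]) the FULL printed budget. [cite: Balaban1989LargeFieldII, p.387 ll.23–27, (1.80) p.384] -/
theorem improved189_full_of_budget_general {V : Type*} (T1X : V → ℝ) (b : Step.Budget.Consts) (k : ℕ)
    (κ P c₀ κ₁ dX d' c L : ℝ)
    (hT : ∀ v, T1X v ≤ Real.exp (-κ - P))
    (hcost : b.cost (k + 1) d' ≤ κ)
    (hgeo : dX ≤ c * (L * b.R (k + 1)) ^ b.d * (d' + 1))
    (hκ : 0 ≤ κ₁) (hL : 0 ≤ L) (hR : 0 ≤ b.R (k + 1)) (hc : 0 ≤ c) (hd' : 1 ≤ d')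
    (hslope2 : 2 * (κ₁ * c * L ^ b.d) ≤ b.C * b.M ^ b.d * b.R (k + 1))
    (hP : c₀ ≤ P) :
    ∀ v, T1X v ≤ Real.exp (-c₀ - κ₁ * dX) := by
  intro v
  refine le_trans (hT v) (Real.exp_le_exp.mpr ?_)
  have hRd : 0 ≤ (b.R (k + 1)) ^ b.d := by positivity
  have hA : 0 ≤ κ₁ * c * L ^ b.d := by positivity
  -- κ₁ c (LR)^d (d'+1) ≤ 2 κ₁ c (LR)^d d' ≤ cost(d') ≤ κ
  have h1 : κ₁ * dX ≤ (κ₁ * c * L ^ b.d) * (b.R (k + 1)) ^ b.d * (d' + 1) := by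
    have := mul_le_mul_of_nonneg_left hgeo hκ
    have e : κ₁ * (c * (L * b.R (k + 1)) ^ b.d * (d' + 1)) = (κ₁ * c * L ^ b.d) * (b.R (k + 1)) ^ b.d * (d' + 1) := by
      rw [mul_pow]; ring
    linarith [e]
  have h2 : (κ₁ * c * L ^ b.d) * (b.R (k + 1)) ^ b.d * (d' + 1)
      ≤ 2 * (κ₁ * c * L ^ b.d) * (b.R (k + 1)) ^ b.d * d' := by
    have hAR : 0 ≤ (κ₁ * c * L ^ b.d) * (b.R (k + 1)) ^ b.d := mul_nonneg hA hRd
    nlinarith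
  have h3 : 2 * (κ₁ * c * L ^ b.d) * (b.R (k + 1)) ^ b.d * d' ≤ b.cost (k + 1) d' := by
    unfold Step.Budget.Consts.cost
    have hd0 : 0 ≤ d' := by linarith
    have := mul_le_mul_of_nonneg_right (mul_le_mul_of_nonneg_right hslope2 hRd) hd0
    have e : b.C * b.M ^ b.d * b.R (k + 1) * b.R (k + 1) ^ b.d * d' = b.C * b.M ^ b.d * b.R (k + 1) ^ (b.d + 1) * d' := by
      ring
    linarith [e]
  linarith

/-! ## §3. In the index model (no geometric hypothesis) and on the torus catalogue -/

/-- **THE FULL-BUDGET IMPROVED BOUND FOR AN ARBITRARY LARGE-FIELD REGION IN THE INDEX MODEL** (p. 387 ll. 23–27),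
horizon `K ≥ 1`: the hypotheses of the sibling's `improved189_arbitrary_ofIndex` (non-empty face-connected `X₀`, the
factor form, (1.80) with `K ≥ 1` and profile entry `s_{k+1} = treeLen (Sop q X₀)`, dictionary `R·q = L·R_{k+1}`, `b.d = d`)
with `hslope` DOUBLED, `hdef` DROPPED, `d ≥ 1`, and any `c₀ ≤ P`: `𝐓 ≤ exp(−c₀ − κ₁·d_k(X))`.  `hgeo` by `hgeo_of_Sop`,
`hcost` by `cost_succ_le_of_controls`, `d′ ≥ 1` by `one_le_treeLen_Sop`. [cite: Balaban1989LargeFieldII, p.387 ll.23–27, (1.80) p.384] -/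
theorem improved189_arbitrary_full_ofIndex {V : Type*} (T1X : V → ℝ) (b : Step.Budget.Consts) (k K : ℕ) (hK : 1 ≤ K)
    (κ P c₀ κ₁ L : ℝ) (s : ℕ → ℝ) {R q : ℕ} (hR : 0 < R) (hq : 0 < q) (hn : 0 < n)
    {X₀ : Finset (Pt n)} (hX : X₀.Nonempty) (hXc : FaceConnected X₀)
    (hT : ∀ v, T1X v ≤ Real.exp (-κ - P))
    (hctl : Step.Budget.Controls b k K κ s) (hC : 0 ≤ b.C) (hM : 0 ≤ b.M) (hRm : ∀ m, 0 ≤ b.R m) (hs : ∀ m, 0 ≤ s m)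
    (hsize : s (k + 1) = treeLen (Sop q X₀))
    (hdim : b.d = n) (hRq : ((R * q : ℕ) : ℝ) = L * b.R (k + 1))
    (hκ₁ : 0 ≤ κ₁) (hL : 0 ≤ L)
    (hslope2 : 2 * (κ₁ * (4 * 2 ^ n) * L ^ b.d) ≤ b.C * b.M ^ b.d * b.R (k + 1))
    (hP : c₀ ≤ P) :
    ∀ v, T1X v ≤ Real.exp (-c₀ - κ₁ * treeLen (fineCubes R X₀)) := by
  have hgeo : treeLen (fineCubes R X₀) ≤ (4 * 2 ^ n) * (L * b.R (k + 1)) ^ b.d * (s (k + 1) + 1) := by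
    rw [hdim, hsize]
    exact hgeo_of_Sop hR hq hX hXc hRq
  have hd' : 1 ≤ s (k + 1) := by
    rw [hsize]
    exact one_le_treeLen_Sop hn hq hX hXc
  exact improved189_full_of_budget_general T1X b k κ P c₀ κ₁ _ (s (k + 1)) (4 * 2 ^ n) L hT
    (cost_succ_le_of_controls b hK hctl hC hM hRm hs) hgeo hκ₁ hL (hRm _) (by positivity) hd' hslope2 hP

/-- The same ON THE TORUS CATALOGUE of the Cor.-3 chain (`tsys d N`, `dj = torusTreeLen`): for a component `X` whose cube
family is the projection of `fineCubes R X₀`, `𝐓 ≤ exp(−c₀ − κ₁·dj X)` (projection never lengthens). [cite: Balaban1989LargeFieldII, p.387 ll.23–27] -/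
theorem improved189_arbitrary_full_torus {V : Type*} (T1X : V → ℝ) (b : Step.Budget.Consts) (k K : ℕ) (hK : 1 ≤ K)
    (κ P c₀ κ₁ L : ℝ) (s : ℕ → ℝ) {R q : ℕ} (hR : 0 < R) (hq : 0 < q) (hn : 0 < n)
    {X₀ : Finset (Pt n)} (hX : X₀.Nonempty) (hXc : FaceConnected X₀)
    {N : ℕ} [NeZero N] (X : (tsys n N).Dom) (hlift : X.1 = (fineCubes R X₀).image (proj N))
    (hT : ∀ v, T1X v ≤ Real.exp (-κ - P))
    (hctl : Step.Budget.Controls b k K κ s) (hC : 0 ≤ b.C) (hM : 0 ≤ b.M) (hRm : ∀ m, 0 ≤ b.R m) (hs : ∀ m, 0 ≤ s m)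
    (hsize : s (k + 1) = treeLen (Sop q X₀))
    (hdim : b.d = n) (hRq : ((R * q : ℕ) : ℝ) = L * b.R (k + 1))
    (hκ₁ : 0 ≤ κ₁) (hL : 0 ≤ L)
    (hslope2 : 2 * (κ₁ * (4 * 2 ^ n) * L ^ b.d) ≤ b.C * b.M ^ b.d * b.R (k + 1))
    (hP : c₀ ≤ P) :
    ∀ v, T1X v ≤ Real.exp (-c₀ - κ₁ * (tsys n N).dj X) := by
  intro v
  have h := improved189_arbitrary_full_ofIndex T1X b k K hK κ P c₀ κ₁ L s hR hq hn hX hXc hT hctl hC hM hRm hs hsize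
    hdim hRq hκ₁ hL hslope2 hP v
  have hdj : (tsys n N).dj X ≤ treeLen (fineCubes R X₀) :=
    torus_dj_le_treeLen_of_lift X ((fineCubes_nonempty_iff hR).2 hX) (faceConnected_fineCubes hR hXc) hlift
  refine h.trans (Real.exp_le_exp.mpr ?_)
  nlinarith [mul_le_mul_of_nonneg_left hdj hκ₁]

/-- **THE HORIZON-`0` DOMAINS WITH THE FULL BUDGET, FROM (1.80)⁺** (the domains `Y_i` of (1.71), p. 387 ll. 21–24, on the
torus catalogue): for a torus domain `Y` whose cube family is the projection of `fineCubes R SY`, the factor form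
`𝐓 ≤ exp(−κ − P)` (p. 384), the STRENGTHENED inductive statement at the horizon — (1.80)⁺ with `K = 0` and print's terminal
term `t = κ₁·d_k(Y)`, i.e. `κ₁·treeLen (fineCubes R SY) ≤ κ` (`B16Improved189FullBudget.controlsT_zero_iff`) — and any
`c₀ ≤ P` give `𝐓 ≤ exp(−c₀ − κ₁·dj Y)`: the full-budget `K = 0` supply (where `B16Cor3FactorLeavesOfBudget.weight_horizon0_torus`
trades half the budget against condition (i)). [cite: Balaban1989LargeFieldII, p.387 ll.21–27, (1.80) p.384] -/
theorem weight_horizon0_full_torus {V : Type*} (T1X : V → ℝ) (b : Step.Budget.Consts) (k : ℕ) (κ P c₀ κ₁ : ℝ)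
    (s : ℕ → ℝ) {R : ℕ} (hR : 0 < R) {SY : Finset (Pt n)} (hne : SY.Nonempty) (hfc : FaceConnected SY)
    {N : ℕ} [NeZero N] (Y : (tsys n N).Dom) (hlift : Y.1 = (fineCubes R SY).image (proj N))
    (hT : ∀ v, T1X v ≤ Real.exp (-κ - P))
    (hctlT : Step.Budget.Controls b k 0 (κ - κ₁ * treeLen (fineCubes R SY)) s) (hκ₁ : 0 ≤ κ₁) (hP : c₀ ≤ P) :
    ∀ v, T1X v ≤ Real.exp (-c₀ - κ₁ * (tsys n N).dj Y) := by
  intro v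
  have hκ : κ₁ * treeLen (fineCubes R SY) ≤ κ := (controlsT_zero_iff b k κ _ s).mp hctlT
  have hdj : (tsys n N).dj Y ≤ treeLen (fineCubes R SY) :=
    torus_dj_le_treeLen_of_lift Y ((fineCubes_nonempty_iff hR).2 hne) (faceConnected_fineCubes hR hfc) hlift
  refine le_trans (hT v) (Real.exp_le_exp.mpr ?_)
  nlinarith [mul_le_mul_of_nonneg_left hdj hκ₁]

/-! ## §4. The Cor.-3 chain's factor leaves WITH THE FULL BUDGET: `hZ` (𝐓″1 reading), `hw` (Wilson reading), `hY` -/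

/-- **THE LEAF `hZ` WITH THE FULL BUDGET, PER COMPONENT OF `Z_k` OF EVERY TERM** of (1.72) (the `𝐓″1` reading consumed
by `B16Cor3CurlyGas.uvIneq_of_repr172_torus_of_ineq249_of_gas` and, at the record, by
`B16NodeKnitRecord13CoPH.uvIneq_at_record₁₃CoPH_of_gas`): the sibling's `hZ_of_budget_torus` (composite structure `hTZ`,
lifts, horizons `K ≥ 1`, budgets with the (1.79)-factor form, (1.80), profiles with `s_{k+1} = d′_{k+1}(S(X))`, dictionary
`R·q = L·R_{k+1}`) with `2ap ≤ P` replaced by `c₀ ≤ P`, the slope clause DOUBLED and NO deficit clause: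
`(Σ𝐓″_k(Z_k))1 ≤ Π_{X∈Zc t} exp(−c₀ − κ₁·dj X)` — `improved189_arbitrary_full_torus` per component, (1.73) iterated. [cite: Balaban1989LargeFieldII, p.387 ll.23–27, (1.80) p.384, (1.72)–(1.73) pp.379–380] -/
theorem hZ_full_of_budget_torus {Cfg : Type*} {N : ℕ} [NeZero N] (Rp : Repr172 Cfg (tsys n N).Dom)
    (T : Rp.Adm → (tsys n N).Dom → PosOp Cfg) (l : Rp.Adm → List (tsys n N).Dom)
    (hnd : ∀ t, (l t).Nodup) (hset : ∀ t, (l t).toFinset = Rp.Zc t)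
    (hTZ : ∀ t F V, (Rp.TZ t).T F V = (PosOp.pi (T t) (l t)).T F V)
    (b : Step.Budget.Consts) (k : ℕ) (c₀ κ₁ L : ℝ) {R q : ℕ} (hR : 0 < R) (hq : 0 < q) (hn : 0 < n)
    (hC : 0 ≤ b.C) (hM : 0 ≤ b.M) (hRm : ∀ m, 0 ≤ b.R m) (hdim : b.d = n)
    (hRq : ((R * q : ℕ) : ℝ) = L * b.R (k + 1)) (hκ₁ : 0 ≤ κ₁) (hL : 0 ≤ L)
    (hslope2 : 2 * (κ₁ * (4 * 2 ^ n) * L ^ b.d) ≤ b.C * b.M ^ b.d * b.R (k + 1))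
    (X₀ : Rp.Adm → (tsys n N).Dom → Finset (Pt n)) (K : Rp.Adm → (tsys n N).Dom → ℕ)
    (κ P : Rp.Adm → (tsys n N).Dom → ℝ) (s : Rp.Adm → (tsys n N).Dom → ℕ → ℝ)
    (hdata : ∀ t, ∀ X ∈ Rp.Zc t, (X₀ t X).Nonempty ∧ FaceConnected (X₀ t X) ∧
      X.1 = (fineCubes R (X₀ t X)).image (proj N) ∧ 1 ≤ K t X ∧
      (∀ V, (T t X).T 1 V ≤ Real.exp (-(κ t X) - P t X)) ∧ Step.Budget.Controls b k (K t X) (κ t X) (s t X) ∧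
      (∀ m, 0 ≤ s t X m) ∧ s t X (k + 1) = treeLen (Sop q (X₀ t X)) ∧ c₀ ≤ P t X) :
    ∀ t V, (Rp.TZ t).T 1 V ≤ ∏ X ∈ Rp.Zc t, Real.exp (-c₀ - κ₁ * (tsys n N).dj X) := by
  intro t V
  rw [hTZ t, ← hset t]
  refine pi_one_le_prod_of_forall_mem (T t) (fun X => Real.exp (-c₀ - κ₁ * (tsys n N).dj X)) (hnd t) ?_ V
  intro X hX
  have hX' : X ∈ Rp.Zc t := by rw [← hset t]; exact List.mem_toFinset.mpr hX
  obtain ⟨hne, hfc, hlift, hK, hT, hctl, hs, hsize, hP⟩ := hdata t X hX'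
  exact improved189_arbitrary_full_torus (fun V => (T t X).T 1 V) b k (K t X) hK (κ t X) (P t X) c₀ κ₁ L (s t X) hR hq
    hn hne hfc X hlift hT hctl hC hM hRm hs hsize hdim hRq hκ₁ hL hslope2 hP

/-- **THE WILSON-FORM LEAF `hw` WITH THE FULL BUDGET**: as `B16Cor3FactorLeavesOfBudget.hw_of_budget_torus` (the factor
form stated for the weight function `V ↦ 𝐓_X[B_X](V)`), with `c₀ ≤ P`, the slope clause doubled, no deficit clause:
`𝐓_X[B_X] ≤ exp(−c₀ − κ₁·dj X)` for every component of every term — the hypothesis `hw` of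
`B16Cor3Torus.uvIneq_of_repr172_wilson_torus` with `c 0 = c₀ = 2(1+β₀)⁻¹p₀(g_k)`, TWICE the constant
`B16Cor3Wilson.hw_of_improved189` ∕ `hw_of_budget_torus` supply. [cite: Balaban1989LargeFieldII, p.387 ll.23–27, (1.80) p.384, p.380 after (1.73)] -/
theorem hw_full_of_budget_torus {Cfg : Type*} {N : ℕ} [NeZero N] (Rp : Repr172 Cfg (tsys n N).Dom)
    (T : Rp.Adm → (tsys n N).Dom → PosOp Cfg) (B : Rp.Adm → (tsys n N).Dom → Cfg → ℝ)
    (b : Step.Budget.Consts) (k : ℕ) (c₀ κ₁ L : ℝ) {R q : ℕ} (hR : 0 < R) (hq : 0 < q) (hn : 0 < n)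
    (hC : 0 ≤ b.C) (hM : 0 ≤ b.M) (hRm : ∀ m, 0 ≤ b.R m) (hdim : b.d = n)
    (hRq : ((R * q : ℕ) : ℝ) = L * b.R (k + 1)) (hκ₁ : 0 ≤ κ₁) (hL : 0 ≤ L)
    (hslope2 : 2 * (κ₁ * (4 * 2 ^ n) * L ^ b.d) ≤ b.C * b.M ^ b.d * b.R (k + 1))
    (X₀ : Rp.Adm → (tsys n N).Dom → Finset (Pt n)) (K : Rp.Adm → (tsys n N).Dom → ℕ)
    (κ P : Rp.Adm → (tsys n N).Dom → ℝ) (s : Rp.Adm → (tsys n N).Dom → ℕ → ℝ)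
    (hdata : ∀ t, ∀ X ∈ Rp.Zc t, (X₀ t X).Nonempty ∧ FaceConnected (X₀ t X) ∧
      X.1 = (fineCubes R (X₀ t X)).image (proj N) ∧ 1 ≤ K t X ∧
      (∀ V, (T t X).T (B t X) V ≤ Real.exp (-(κ t X) - P t X)) ∧ Step.Budget.Controls b k (K t X) (κ t X) (s t X) ∧
      (∀ m, 0 ≤ s t X m) ∧ s t X (k + 1) = treeLen (Sop q (X₀ t X)) ∧ c₀ ≤ P t X) :
    ∀ t, ∀ X ∈ Rp.Zc t, ∀ V, (T t X).T (B t X) V ≤ Real.exp (-c₀ - κ₁ * (tsys n N).dj X) := by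
  intro t X hX
  obtain ⟨hne, hfc, hlift, hK, hT, hctl, hs, hsize, hP⟩ := hdata t X hX
  exact improved189_arbitrary_full_torus (fun V => (T t X).T (B t X) V) b k (K t X) hK (κ t X) (P t X) c₀ κ₁ L (s t X)
    hR hq hn hne hfc X hlift hT hctl hC hM hRm hs hsize hdim hRq hκ₁ hL hslope2 hP

/-- **THE LEAF `hY` WITH THE FULL BUDGET FROM (1.80)⁺ AT THE HORIZON, PER DOMAIN `Y_i` OF EVERY TERM**: the composite
`Π_i𝐓_k(Y_i)` is `PosOp.pi (TY t)` over a nodup enumeration of `Ys t` (`hTYs`), and every `Y ∈ Ys t` carries a lift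
`SY t Y` (non-empty, face-connected, projecting onto `Y`), a budget `κY` with the factor form `𝐓 ≤ exp(−κY − PY)`, the
strengthened statement (1.80)⁺ at `K = 0` with print's terminal term `κ₁·d_k(Y)` (`Controls b k 0 (κY − κ₁·d) sY`), and
`c₀ ≤ PY`: `(Π_i𝐓_k(Y_i))1 ≤ Π_{Y∈Ys t} exp(−c₀ − κ₁·dj Y)` — `weight_horizon0_full_torus` per domain. [cite: Balaban1989LargeFieldII, (1.72)–(1.73) pp.379–380, p.387 ll.21–27, (1.80) p.384] -/
theorem hY_full_of_controlsT_torus {Cfg : Type*} {N : ℕ} [NeZero N] (Rp : Repr172 Cfg (tsys n N).Dom)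
    (TY : Rp.Adm → (tsys n N).Dom → PosOp Cfg) (lY : Rp.Adm → List (tsys n N).Dom)
    (hndY : ∀ t, (lY t).Nodup) (hsetY : ∀ t, (lY t).toFinset = Rp.Ys t)
    (hTYs : ∀ t F V, (Rp.TYs t).T F V = (PosOp.pi (TY t) (lY t)).T F V)
    (b : Step.Budget.Consts) (k : ℕ) (c₀ κ₁ : ℝ) {R : ℕ} (hR : 0 < R) (hκ₁ : 0 ≤ κ₁)
    (SY : Rp.Adm → (tsys n N).Dom → Finset (Pt n)) (κY PY : Rp.Adm → (tsys n N).Dom → ℝ)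
    (sY : Rp.Adm → (tsys n N).Dom → ℕ → ℝ)
    (hdata : ∀ t, ∀ Y ∈ Rp.Ys t, (SY t Y).Nonempty ∧ FaceConnected (SY t Y) ∧
      Y.1 = (fineCubes R (SY t Y)).image (proj N) ∧ (∀ V, (TY t Y).T 1 V ≤ Real.exp (-(κY t Y) - PY t Y)) ∧
      Step.Budget.Controls b k 0 (κY t Y - κ₁ * treeLen (fineCubes R (SY t Y))) (sY t Y) ∧ c₀ ≤ PY t Y) :
    ∀ t V, (Rp.TYs t).T 1 V ≤ ∏ Y ∈ Rp.Ys t, Real.exp (-c₀ - κ₁ * (tsys n N).dj Y) := by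
  intro t V
  rw [hTYs t, ← hsetY t]
  refine pi_one_le_prod_of_forall_mem (TY t) (fun Y => Real.exp (-c₀ - κ₁ * (tsys n N).dj Y)) (hndY t) ?_ V
  intro Y hY
  have hY' : Y ∈ Rp.Ys t := by rw [← hsetY t]; exact List.mem_toFinset.mpr hY
  obtain ⟨hne, hfc, hlift, hT, hctlT, hP⟩ := hdata t Y hY'
  exact weight_horizon0_full_torus (fun V => (TY t Y).T 1 V) b k (κY t Y) (PY t Y) c₀ κ₁ (sY t Y) hR hne hfc Y hlift
    hT hctlT hκ₁ hP

/-! ## §5. From (1.80) for every component (`ScaleData.Invariant`) and from the index-model PROFILE -/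

/-- **FROM (1.80) FOR EVERY COMPONENT OF `Z_k`** (`Step.Budget.ScaleData.Invariant`, the output of
`B16Lem384Induction.invariant_all_ofIndex`): the full-budget bound of §3 for a component `Z` with `K(Z) ≥ 1` — §3 with
`hctl := hinv Z` (the sibling's `improved189_arbitrary_of_invariant` without `hdef`, slope doubled). [cite: Balaban1989LargeFieldII, p.387 ll.23–27, (1.80) p.384] -/
theorem improved189_arbitrary_full_of_invariant {V : Type*} (T1X : V → ℝ) (b : Step.Budget.Consts) {k : ℕ}
    (D : Step.Budget.ScaleData k) (hinv : D.Invariant b) (Z : D.Comp) (hK : 1 ≤ D.K Z)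
    (P c₀ κ₁ L : ℝ) {R q : ℕ} (hR : 0 < R) (hq : 0 < q) (hn : 0 < n)
    {X₀ : Finset (Pt n)} (hX : X₀.Nonempty) (hXc : FaceConnected X₀)
    (hT : ∀ v, T1X v ≤ Real.exp (-(D.κ Z) - P))
    (hC : 0 ≤ b.C) (hM : 0 ≤ b.M) (hRm : ∀ m, 0 ≤ b.R m) (hs : ∀ m, 0 ≤ D.size Z m)
    (hsize : D.size Z (k + 1) = treeLen (Sop q X₀))
    (hdim : b.d = n) (hRq : ((R * q : ℕ) : ℝ) = L * b.R (k + 1)) (hκ₁ : 0 ≤ κ₁) (hL : 0 ≤ L)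
    (hslope2 : 2 * (κ₁ * (4 * 2 ^ n) * L ^ b.d) ≤ b.C * b.M ^ b.d * b.R (k + 1)) (hP : c₀ ≤ P) :
    ∀ v, T1X v ≤ Real.exp (-c₀ - κ₁ * treeLen (fineCubes R X₀)) :=
  improved189_arbitrary_full_ofIndex T1X b k (D.K Z) hK (D.κ Z) P c₀ κ₁ L (D.size Z) hR hq hn hX hXc hT (hinv Z) hC hM
    hRm hs hsize hdim hRq hκ₁ hL hslope2 hP

/-- **READ FROM THE INDEX-MODEL PROFILE** of `B16Lem384Induction` §§8–9 (`s = fun m => treeLen (Siter (ratio L σ) (m − k)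
X₀)`, exponents `R_k = L^{σ₀}`, `R_{k+1} = L^{σ₁}`, `σ₀ ≤ σ₁ + 1`): §3 with `hsize`, `hRq` and the profile's non-negativity
DERIVED (the sibling's `profile_entry_succ` ∕ `dictionary_of_exponents`), full budget. [cite: Balaban1989LargeFieldII, p.387 ll.23–27, (1.80) p.384; Balaban1988Convergent, (2.5) p.255, (2.9) p.256] -/
theorem improved189_arbitrary_full_ofIndexProfile {V : Type*} (T1X : V → ℝ) (b : Step.Budget.Consts) (k K : ℕ)
    (hK : 1 ≤ K) (κ P c₀ κ₁ : ℝ) {L : ℕ} (hL : 0 < L) (hn : 0 < n) (σ : ℕ → ℕ) (Rnat : ℕ → ℕ)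
    (hRk : Rnat k = L ^ σ 0) (hRk1 : Rnat (k + 1) = L ^ σ 1) (hlag : σ 0 ≤ σ 1 + 1)
    (hbR : b.R (k + 1) = (Rnat (k + 1) : ℝ))
    {X₀ : Finset (Pt n)} (hX : X₀.Nonempty) (hXc : FaceConnected X₀)
    (hT : ∀ v, T1X v ≤ Real.exp (-κ - P))
    {s : ℕ → ℝ} (hctl : Step.Budget.Controls b k K κ s) (hC : 0 ≤ b.C) (hM : 0 ≤ b.M) (hRm : ∀ m, 0 ≤ b.R m)
    (hsize : s = fun m => treeLen (Siter (ratio L σ) (m - k) X₀))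
    (hdim : b.d = n) (hκ₁ : 0 ≤ κ₁)
    (hslope2 : 2 * (κ₁ * (4 * 2 ^ n) * (L : ℝ) ^ b.d) ≤ b.C * b.M ^ b.d * b.R (k + 1)) (hP : c₀ ≤ P) :
    ∀ v, T1X v ≤ Real.exp (-c₀ - κ₁ * treeLen (fineCubes (Rnat k) X₀)) := by
  have hs : ∀ m, 0 ≤ s m := fun m => by rw [hsize]; exact treeLen_nonneg _
  have hsize' : s (k + 1) = treeLen (Sop (ratio L σ 0) X₀) := by rw [hsize]; exact profile_entry_succ L σ k X₀
  have hR : 0 < Rnat k := by rw [hRk]; exact Nat.pow_pos hL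
  have hRq : ((Rnat k * ratio L σ 0 : ℕ) : ℝ) = (L : ℝ) * b.R (k + 1) := by
    rw [dictionary_of_exponents L σ (Rnat k) (Rnat (k + 1)) hRk hRk1 hlag, Nat.cast_mul, hbR]
  exact improved189_arbitrary_full_ofIndex T1X b k K hK κ P c₀ κ₁ (L : ℝ) s hR (ratio_pos hL σ 0) hn hX hXc hT hctl hC
    hM hRm hs hsize' hdim hRq hκ₁ (Nat.cast_nonneg _) hslope2 hP

/-! ## §6. Non-vacuity of §2: the doubled slope clause, `d′ ≥ 1` and the factor form jointly inhabited -/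

/-- **§2's hypotheses are jointly satisfiable with a non-zero size and the bound then fires**: bookkeeping constants
`O(1) = M = 1`, `d_b = 1`, `R ≡ 1` (so `cost n s = s`), scale `k = 0`, budget `κ = 2`, `P = c₀ = 0`, size `d′ = 1`,
comparison constant `c = 1`, `L = 1`, `κ₁ = 1∕2` (`2κ₁cL^d = 1 ≤ O(1)M^dR`), linear size `d_k(X) = 2 ≤ c(LR)^d(d′+1)`: any
factor bound `𝐓 ≤ exp(−2 − 0)` yields `𝐓 ≤ exp(−0 − (1∕2)·2)`. [cite: Balaban1989LargeFieldII, p.387 ll.23–27] -/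
theorem toy_full_of_budget_general {V : Type*} (T1X : V → ℝ) (hT : ∀ v, T1X v ≤ Real.exp (-2 - 0)) :
    ∀ v, T1X v ≤ Real.exp (-0 - (1 / 2 : ℝ) * 2) := by
  let b : Step.Budget.Consts := ⟨1, 1, 1, fun _ => 1⟩
  have hcost : b.cost (0 + 1) 1 ≤ 2 := by simp [b, Step.Budget.Consts.cost]
  exact improved189_full_of_budget_general T1X b 0 2 0 0 (1 / 2) 2 1 1 1 hT hcost (by simp [b]; norm_num) (by norm_num)
    zero_le_one (by simp [b]) zero_le_one le_rfl (by simp [b]) le_rfl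

end Literature.MathematicalPhysics.QuantumFieldTheory.Balaban1983to89.B16Improved189ArbitraryRegionFull

end
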